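import Summits.MatrixMultiplication.MatrixMultiplication.Theses.FidelityWitnesses
import Literature.Computability.AlgebraicComplexity.SmallFormatRank

/-!
# Disproof of `FidelityGapTwoSix` (stmt-MatrixMultiplication-4957) — findings

Crux (route `FidelityWitnesses`, rank 2):
`∃ ε > 0, ∀ S : P2 → P2 → P2 → ℂ, tensorRank S ≤ 6 → ‖Σ S·⟨2,2,2⟩‖² ≤ (1 − ε)·8·Σ‖S‖²`.

VERDICT OF THE STANDING ADVERSARY: **no kill is possible** — the crux is TRUE.  It is the metric
shadow of `7 ≤ R̲(⟨2,2,2⟩)` (Landsberg 2005), which is a sorry-free TREE THEOREM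
(`Landsberg2005_borderRank_matMulTensor_two_holds`, read through Alder's theorem and
`…_iff_notMem_closure`); the line lead's `closure-transfer` proof (p72353) closes it.  The only
attack surface was the formalisation (junk in `tensorRank` / `matMulTensor`): checked — over `ℂ` with
finite index types `tensorRank` is the honest minimum (`tensorRank_le_card`), and
`matMulTensor ℂ 2 2 2` is `⟨2,2,2⟩` in Bläser's slot order `(Z, X, Y)`; the missing `conj` is
immaterial because `⟨2,2,2⟩` is real.

What this file PROVES instead (all kernel-checked, no `sorry`; the provers may import the landed
copies under `Theorems/FidelityGapTwoSix/Negative/`):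

* (a) LOAD-BEARING: the rank bound `6` is sharp — `FidelityGapTwoSixWithoutRankSix` (the crux with
  `≤ 7` in place of `≤ 6`) is FALSE: `S := ⟨2,2,2⟩` itself has rank `≤ 7` (Strassen, tree) and
  fidelity `1` (`fidelityGapTwoSix_false_without_rankSix`).  The hypothesis `0 < ε` is the whole
  content: with `ε = 0` the inequality is Cauchy–Schwarz and needs no rank bound (not formalised).
* (b) TIGHTNESS: every admissible `ε` satisfies `ε ≤ 1/8` (`fidelityGapTwoSix_eps_le_one_eighth`).
  Witness: `S₀ := ⟨2,2,2⟩ − e_{(0,1)} ⊗ e_{(0,0)} ⊗ e_{(0,1)}` (matrix multiplication with the single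
  product `X₀₀Y₀₁` dropped from `Z₀₁`) has HONEST rank `≤ 6` — an explicit `{0,±1}` six-triad
  decomposition (`tensorRank_matMulTensor_two_sub_term_le_six`; it is Strassen's scheme minus its
  `M₃` term, moved by the isotropy element `(P,Q,R) = ([[1,0],[-1,1]], [[1,-1],[0,1]], I)`), and
  `Σ S₀·T = 7`, `Σ‖S₀‖² = 7`, so its fidelity is `49/56 = 7/8`.  Hence `SevenEighthsLaw` (4959) is the
  OPTIMAL form of the crux and its constant `7` is ATTAINED inside `σ₆⁰` (honest rank 6), not only on
  the border; `dist(⟨2,2,2⟩, {rank ≤ 6}) ≤ 1`.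
* (c) NATURAL STRENGTHENINGS REFUTED: (c1) any `ε > 1/8` (from (b));
  (c2) ADDITIVITY AT RANK 6, `M(2,6) ≤ 6` ("six multiplications capture at most six of the eight
  units"), is FALSE with the same integer witness: `49 > 6·7` (`not_fidelity_additive_at_six`) — so
  super-additivity of fidelity, which `RankThreeDefect` (4965) asserts at rank 3 with a numerical
  complex witness, holds at rank 6 with an exact `{0,1}` witness.
* (d) TARGETS (lead's stubs `stub_coneClosure`, `stub_rankConeSmul`): both TRUE, nothing to break —
  `stub_rankConeSmul` is the tree lemma `tensorRank_smul_le`; `stub_coneClosure` checked on paper incl.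
  corners (`T = 0` or `C = ∅` make its hypothesis unsatisfiable at every `ε < 1`; for `S ≠ 0` project
  `T` on `ℂ·S`: `‖T − cS‖² = ‖T‖² − |⟨S,T⟩|²/‖S‖² < ε‖T‖²`).
* (e) OPEN NEAR-MISS (not a statement of this crux): `SevenEighthsLaw` itself, `M(2,6) = 7`, i.e.
  `dist(⟨2,2,2⟩, σ₆) = 1`.  Evidence for: planner kit j005236 (40/40 restarts ≤ 7.000000000000),
  refuter g40-54 (≤ 6.794 honest ascent), and (b) shows 7 is attained at a critical point
  (`E ⟂ T_{S₀}σ₆`: every triad of the decomposition below meets at most one of the three coordinates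
  of `E`).  My own independent attack (complex ALS on `min ‖T − S‖²`, rank 6, border-seeded restarts)
  is kit job j007943 (queued 2026-08-16T00:50Z, results appended to this docstring when delivered); an
  error `< 1` there would refute 4959 by an exact Gaussian-rational witness.
-/

namespace Summit.MatrixMultiplication.MatrixMultiplication.Cruxes.FidelityGapTwoSix.Disproof

open scoped BigOperators
open Literature.Computability.AlgebraicComplexity

/-- The index type of `2 × 2` matrix positions. -/
abbrev P2 := Fin 2 × Fin 2

/-! ## (b) The honest rank-6 witness `S₀ = ⟨2,2,2⟩ − E` -/

section AnyRing

variable (K : Type*) [CommRing K]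

/-- The dropped standard triad `E = e_{(0,1)} ⊗ e_{(0,0)} ⊗ e_{(0,1)}` (the product `X₀₀·Y₀₁`
inside `Z₀₁`), one of the eight `1`-entries of `⟨2,2,2⟩`. [folklore] -/
def droppedTerm : P2 → P2 → P2 → K :=
  triad (posInd K 0 1) (posInd K 0 0) (posInd K 0 1)

/-- `S₀ := ⟨2,2,2⟩ − E`: `2 × 2` matrix multiplication with one of its eight products deleted.
[folklore] -/
def subTerm : P2 → P2 → P2 → K :=
  matMulTensor K 2 2 2 - droppedTerm K

/-- Output patterns (slot `Z`) of the six triads decomposing `S₀`. [folklore] -/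
def subW : Fin 6 → P2 → K :=
  ![posInd K 0 0 - posInd K 1 0 + posInd K 1 1, posInd K 1 0 - posInd K 1 1, posInd K 0 0,
    posInd K 0 1 + posInd K 1 0 - posInd K 0 0 - posInd K 1 1, posInd K 1 1,
    posInd K 0 0 - posInd K 1 0]

/-- Left factors (slot `X`) of the six triads decomposing `S₀`. [folklore] -/
def subU : Fin 6 → P2 → K :=
  ![posInd K 0 1 + posInd K 1 1 - posInd K 1 0, posInd K 0 1 + posInd K 1 1,
    posInd K 0 0 + posInd K 1 0 - posInd K 0 1 - posInd K 1 1, posInd K 0 1, posInd K 1 0,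
    posInd K 1 0 - posInd K 1 1]

/-- Right factors (slot `Y`) of the six triads decomposing `S₀`. [folklore] -/
def subV : Fin 6 → P2 → K :=
  ![posInd K 0 0 + posInd K 1 0 + posInd K 1 1, posInd K 0 0 + posInd K 1 0, posInd K 0 0,
    posInd K 1 1, posInd K 0 0 + posInd K 0 1 + posInd K 1 0 + posInd K 1 1,
    posInd K 1 0 + posInd K 1 1]

/-- **`⟨2,2,2⟩ − E` is a sum of six triads** (Strassen's scheme without `M₃`, transported by the
isotropy element `(P,Q,R) = ([[1,0],[-1,1]],[[1,-1],[0,1]],I)` so that `M₃ ↦ E`), checked on all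
`64` entries over any commutative ring. [folklore] -/
theorem subTerm_eq_sum : subTerm K = ∑ r, triad (subW K r) (subU K r) (subV K r) := by
  funext a b c
  obtain ⟨a1, a2⟩ := a
  obtain ⟨b1, b2⟩ := b
  obtain ⟨c1, c2⟩ := c
  rw [Finset.sum_apply, Finset.sum_apply, Finset.sum_apply]
  fin_cases a1 <;> fin_cases a2 <;> fin_cases b1 <;> fin_cases b2 <;> fin_cases c1 <;>
    fin_cases c2 <;>
    simp [Fin.sum_univ_six, triad_apply, subTerm, droppedTerm, subW, subU, subV, posInd,
      matMulTensor]

/-- **`R(⟨2,2,2⟩ − E) ≤ 6`** over any commutative ring (in fact `= 6` over fields, since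
`R(⟨2,2,2⟩) = 7`). [folklore] -/
theorem tensorRank_subTerm_le_six : tensorRank (subTerm K) ≤ 6 :=
  tensorRank_le_of_eq_sum _ _ _ (subTerm_eq_sum K)

end AnyRing

/-- Restatement with the witness spelled out: `R(⟨2,2,2⟩ − e_{(0,1)}⊗e_{(0,0)}⊗e_{(0,1)}) ≤ 6`
over `ℂ`. [folklore] -/
theorem tensorRank_matMulTensor_two_sub_term_le_six :
    tensorRank (matMulTensor ℂ 2 2 2 - triad (posInd ℂ 0 1) (posInd ℂ 0 0) (posInd ℂ 0 1)) ≤ 6 :=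
  tensorRank_subTerm_le_six ℂ

/-- The bilinear overlap `Σ S₀·⟨2,2,2⟩ = 7`. [folklore] -/
theorem overlap_subTerm :
    (∑ a, ∑ b, ∑ c, subTerm ℂ a b c * matMulTensor ℂ 2 2 2 a b c) = 7 := by
  simp only [Fintype.sum_prod_type, Fin.sum_univ_two, subTerm, droppedTerm, Pi.sub_apply,
    triad_apply, posInd, matMulTensor]
  norm_num

/-- `Σ‖S₀‖² = 7`. [folklore] -/
theorem normSq_subTerm :
    (∑ a, ∑ b, ∑ c, ‖subTerm ℂ a b c‖ ^ 2) = (7 : ℝ) := by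
  simp only [Fintype.sum_prod_type, Fin.sum_univ_two, subTerm, droppedTerm, Pi.sub_apply,
    triad_apply, posInd, matMulTensor]
  norm_num

/-- **(b) TIGHTNESS — no fidelity gap beyond `1/8` at `(n, r) = (2, 6)`.**  If `ε` is admissible in
`FidelityGapTwoSix`, then `ε ≤ 1/8`: the honest rank-`6` tensor `S₀ = ⟨2,2,2⟩ − E` has
`|Σ S₀·T|² = 49 = (7/8)·8·Σ‖S₀‖²`.  Equivalently `M(2,6) ≥ 7` is ATTAINED in `σ₆⁰`, so
`SevenEighthsLaw` (`M(2,6) ≤ 7`) is the optimal form of the crux. [folklore] -/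
theorem fidelityGapTwoSix_eps_le_one_eighth {ε : ℝ}
    (h : ∀ S : P2 → P2 → P2 → ℂ, tensorRank S ≤ 6 →
      ‖∑ a, ∑ b, ∑ c, S a b c * matMulTensor ℂ 2 2 2 a b c‖ ^ 2 ≤
        (1 - ε) * 8 * ∑ a, ∑ b, ∑ c, ‖S a b c‖ ^ 2) :
    ε ≤ 1 / 8 := by
  have key := h (subTerm ℂ) (tensorRank_subTerm_le_six ℂ)
  rw [overlap_subTerm, normSq_subTerm] at key
  norm_num at key
  linarith

/-- (c1) The strengthening of the crux to any fixed `ε > 1/8` is false. [folklore] -/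
theorem not_fidelityGapTwoSix_gt_one_eighth :
    ¬ ∃ ε : ℝ, 1 / 8 < ε ∧ ∀ S : P2 → P2 → P2 → ℂ, tensorRank S ≤ 6 →
      ‖∑ a, ∑ b, ∑ c, S a b c * matMulTensor ℂ 2 2 2 a b c‖ ^ 2 ≤
        (1 - ε) * 8 * ∑ a, ∑ b, ∑ c, ‖S a b c‖ ^ 2 := by
  rintro ⟨ε, hε, h⟩
  exact absurd (fidelityGapTwoSix_eps_le_one_eighth h) (not_le.mpr hε)

/-- (c2) **Fidelity is NOT additive at rank 6**: the strengthening `M(2,6) ≤ 6` ("six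
multiplications capture at most six of the eight unit products") fails — `S₀` of rank `≤ 6` has
`|Σ S₀·T|² = 49 > 42 = 6·Σ‖S₀‖²`.  An exact `{0,1}`-valued companion of `RankThreeDefect`. [folklore] -/
theorem not_fidelity_additive_at_six :
    ¬ ∀ S : P2 → P2 → P2 → ℂ, tensorRank S ≤ 6 →
      ‖∑ a, ∑ b, ∑ c, S a b c * matMulTensor ℂ 2 2 2 a b c‖ ^ 2 ≤
        6 * ∑ a, ∑ b, ∑ c, ‖S a b c‖ ^ 2 := by
  intro h
  have key := h (subTerm ℂ) (tensorRank_subTerm_le_six ℂ)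
  rw [overlap_subTerm, normSq_subTerm] at key
  norm_num at key

/-- The super-additive witness, existential form (`∃ S, R(S) ≤ 6 ∧ 6·Σ‖S‖² < |Σ S·T|²`). [folklore] -/
theorem exists_rank_six_fidelity_gt_six :
    ∃ S : P2 → P2 → P2 → ℂ, tensorRank S ≤ 6 ∧
      6 * ∑ a, ∑ b, ∑ c, ‖S a b c‖ ^ 2 <
        ‖∑ a, ∑ b, ∑ c, S a b c * matMulTensor ℂ 2 2 2 a b c‖ ^ 2 := by
  refine ⟨subTerm ℂ, tensorRank_subTerm_le_six ℂ, ?_⟩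
  rw [overlap_subTerm, normSq_subTerm]
  norm_num

/-! ## (a) Load-bearing hypothesis: the rank bound `6` -/

/-- The crux with its rank bound RELAXED from `6` to `7` (hypothesis `tensorRank S ≤ 6` weakened).
[folklore] -/
def FidelityGapTwoSixWithoutRankSix : Prop :=
  ∃ ε : ℝ, 0 < ε ∧ ∀ S : P2 → P2 → P2 → ℂ, tensorRank S ≤ 7 →
    ‖∑ a, ∑ b, ∑ c, S a b c * matMulTensor ℂ 2 2 2 a b c‖ ^ 2 ≤
      (1 - ε) * 8 * ∑ a, ∑ b, ∑ c, ‖S a b c‖ ^ 2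

/-- The self-overlap `Σ T·T = 8` of `T = ⟨2,2,2⟩`. [folklore] -/
theorem overlap_matMulTensor_two :
    (∑ a, ∑ b, ∑ c, matMulTensor ℂ 2 2 2 a b c * matMulTensor ℂ 2 2 2 a b c) = 8 := by
  simp only [Fintype.sum_prod_type, Fin.sum_univ_two, matMulTensor]
  norm_num

/-- `Σ‖T‖² = 8` for `T = ⟨2,2,2⟩`. [folklore] -/
theorem normSq_matMulTensor_two :
    (∑ a, ∑ b, ∑ c, ‖matMulTensor ℂ 2 2 2 a b c‖ ^ 2) = (8 : ℝ) := by
  simp only [Fintype.sum_prod_type, Fin.sum_univ_two, matMulTensor]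
  norm_num

/-- **(a) Any proof must use the rank bound `6`**: with `≤ 7` the gap is false, witnessed by
`S := ⟨2,2,2⟩` itself (`R(⟨2,2,2⟩) ≤ 7`, Strassen 1969 — tree theorem
`tensorRank_matMulTensor_two_le_seven`), whose fidelity is `64/(8·8) = 1`. [folklore] -/
theorem fidelityGapTwoSix_false_without_rankSix : ¬ FidelityGapTwoSixWithoutRankSix := by
  rintro ⟨ε, hε, h⟩
  have key := h (matMulTensor ℂ 2 2 2) (tensorRank_matMulTensor_two_le_seven ℂ)
  rw [overlap_matMulTensor_two, normSq_matMulTensor_two] at key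
  norm_num at key
  linarith

/-! ## (d) Targets

The lead's registered stubs (`stub_coneClosure`, `stub_rankConeSmul`, line `closure-transfer`) are
both TRUE (see the module docstring); no `_false` theorem is possible.  Nothing here. -/

/-! ## (e) Near-misses / open

`SevenEighthsLaw` (item 4959, `M(2,6) ≤ 7`): not refuted; (b) shows it is sharp and attained at an
honest rank-6 critical point.  See the module docstring for the numerical record. -/

end Summit.MatrixMultiplication.MatrixMultiplication.Cruxes.FidelityGapTwoSix.Disproof
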